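import Mathlib.LinearAlgebra.Charpoly.Basic
import Mathlib.LinearAlgebra.FiniteDimensional.Lemmas
import Mathlib.LinearAlgebra.Basis.VectorSpace
import Mathlib.LinearAlgebra.Projection
import Mathlib.FieldTheory.IntermediateField.Adjoin.Basic
import Mathlib.RingTheory.AlgebraicIndependent.TranscendenceBasis
import Mathlib.SetTheory.Cardinal.Arithmetic
import Mathlib.Analysis.Complex.Basic
import Literature.NumberTheory.Transcendental.OneMotiveToric
import Literature.NumberTheory.Transcendental.SchanuelEclEmptyProofs
import Literature.Barriers.Schanuel.LargeTranscendenceDegree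
import Literature.Barriers.Schanuel.AlgebraicIndependenceOfLogarithms
import HarnessLib

/-!
# Rank-one grids `xᵢyⱼ`: linear rank versus transcendence degree (tools, Lemma A, columns)

For `ℚ`-linearly independent `x₁, …, x_d` and `y₁, …, y_ℓ` in `ℂ` write `P = {xᵢyⱼ}`,
`r = dim_ℚ span_ℚ P` and `a = trdeg_ℚ ℚ(P)`. This file and its continuation
`RankOneGridTrdegSchanuel.lean` prove the elementary inequality

  (★) `a + (min(d, ℓ) - 1) ≤ r` (`trdeg_add_min_sub_one_le_finrank_grid`, in the continuation),

and deduce from Schanuel's conjecture (`∀ n, SchanuelRank n`, Roy 2001 Conjecture 1 = the summit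
`Schanuel`) that `trdeg_ℚ ℚ(e^{xᵢyⱼ}) ≥ min(d, ℓ) - 1 ≥ [dℓ/(ℓ+d)]` — the `t`-clause of
M. Waldschmidt's Conjecture 2.3 (Nesterenko–Philippon (eds.), LNM 1752, Ch. 14; the registered
open statement `Literature.Barriers.Schanuel.WaldschmidtConjecture_2_3`), whose derivation from
Schanuel is assembled in `Literature/Barriers/Schanuel/LargeTranscendenceDegreeConjectureProofs.lean`.
The statements and proofs below are ours (elementary linear algebra and the tower law for
transcendence degree); we know no printed source for (★), so everything is tagged `[folklore]` and
fully proved.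

## Content of this file

* Tools: `trdeg_adjoin_le_mk` (`trdeg_F F(S) ≤ #S`), `span_le_adjoin`, `trdeg_adjoin_union_le`
  (subadditivity `trdeg K(S ∪ T) ≤ trdeg K(S) + trdeg K(T)`). Monotonicity of `trdeg` along
  `L ≤ L'` and `trdeg K(S ∪ T) = trdeg K(S)` for `T` algebraic are the tree's
  `Literature.Barriers.Schanuel.trdeg_mono` and
  `Literature.Barriers.Schanuel.trdeg_adjoin_union_eq_of_isAlgebraic` (imported, not restated).
* **Lemma A** (`trdeg_add_finrank_stab_le`): for `u₁, …, u_d ∈ ℂ`, `X = span_ℚ(u)` and `ρ`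
  transcendental over `ℚ`, with `W = {v ∈ X ; ρv ∈ X}`: `trdeg_ℚ ℚ(u) + dim W ≤ d + 1`.
  Proof: `X = W ⊕ C`; for `v ∈ W` write `ρv = ψ(v) + c(v)`, `ψ : W → W` linear, `c(v) ∈ C`; by
  induction `ρᵏv ≡ ψᵏv` modulo the field `F = ℚ(ρ, C)`; for `p = charpoly(ψ)` Cayley–Hamilton gives
  `p(ρ)v ∈ F`, and `p(ρ) ≠ 0` (transcendence), so `v ∈ F`; hence `X ⊆ F` and
  `trdeg ℚ(u) ≤ 1 + dim C`. (The lemma FAILS for algebraic `ρ`: `X = F + Ft + Fs` with `ρ ∈ F`.)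
* Columns `Cⱼ = (xᵢyⱼ)ᵢ` (`gridCol`), the products in a set `J` of columns (`gridCols`), and the
  two facts driving the filtration of the continuation file: adding a column `k` to `J ∋ j₀` adds
  the single field generator `x_{i₀}y_k` (`adjoin_gridCols_insert`, so `trdeg` rises by at most one,
  `trdeg_adjoin_gridCols_insert_le`), and adds nothing at all if the span of column `k` meets the
  span of the columns `J` non-trivially (`adjoin_gridCols_insert_eq_of_inf_ne_bot`).

## References

* [NesterenkoPhilippon2001] Yu. V. Nesterenko, P. Philippon (eds.), *Introduction to Algebraic
  Independence Theory*, LNM 1752 (2001), Ch. 14 (M. Waldschmidt), Conjecture 2.3, p. 214.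
* [Roy2001] D. Roy, *An arithmetic criterion for the values of the exponential function*,
  Acta Arith. 97 (2001), Conjecture 1 (Schanuel's conjecture for rank `n`, `SchanuelRank`).
-/

noncomputable section

open Complex IntermediateField Cardinal
open Literature.Barriers.Schanuel (trdeg_mono trdeg_adjoin_union_eq_of_isAlgebraic)

namespace Literature.NumberTheory.Transcendental

/-! ### Small tools -/

/-- A field generated by a set `S` has transcendence degree `≤ #S`. [folklore] -/
theorem trdeg_adjoin_le_mk {F E : Type*} [Field F] [Field E] [Algebra F E] (S : Set E) :
    Algebra.trdeg F ↥(adjoin F S) ≤ #S := by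
  haveI := isAlgebraic_adjoin_over_algebraAdjoin (F := F) S
  exact (Algebra.IsAlgebraic.trdeg_le_cardinalMk F (((↑) : adjoin F S → E) ⁻¹' S)).trans
    (Cardinal.mk_preimage_of_injective _ _ Subtype.val_injective)

/-- The `ℚ`-span of a set lies in the intermediate field it generates (as sets). [folklore] -/
theorem span_le_adjoin {F E : Type*} [Field F] [Field E] [Algebra F E] (S : Set E) {v : E}
    (hv : v ∈ Submodule.span F S) : v ∈ adjoin F S := by
  induction hv using Submodule.span_induction with
  | mem w hw => exact subset_adjoin F S hw
  | zero => exact zero_mem _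
  | add a b _ _ ha hb => exact add_mem ha hb
  | smul q a _ ha => exact smul_mem _ ha

/-- **Subadditivity of the transcendence degree of generated extensions**:
`trdeg_K K(S ∪ T) ≤ trdeg_K K(S) + trdeg_K K(T)` (tower law along `K ⊆ K(S) ⊆ K(S)(T) = K(S ∪ T)`
and base change `trdeg_{K(S)} K(S)(T) ≤ trdeg_{K(∅)} K(∅)(T) = trdeg_K K(T)`,
`Literature.NumberTheory.Transcendental.trdeg_adjoin_le_of_le`). [folklore] -/
theorem trdeg_adjoin_union_le {K E : Type*} [Field K] [Field E] [Algebra K E] (S T : Set E) :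
    Algebra.trdeg K ↥(adjoin K (S ∪ T)) ≤
      Algebra.trdeg K ↥(adjoin K S) + Algebra.trdeg K ↥(adjoin K T) := by
  have htower := trdeg_add_eq K (adjoin K S) (A := adjoin (adjoin K S) T)
  have heq : Algebra.trdeg K (adjoin (adjoin K S) T) = Algebra.trdeg K (adjoin K (S ∪ T)) := by
    rw [← (equivOfEq (adjoin_adjoin_left K S T)).trdeg_eq]
    rfl
  have hbc := trdeg_adjoin_le_of_le (K := K) (E := E) (F₁ := adjoin K (∅ : Set E))
    (F₂ := adjoin K S) (adjoin.mono K _ _ (Set.empty_subset S)) T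
  have htower0 := trdeg_add_eq K (adjoin K (∅ : Set E)) (A := adjoin (adjoin K (∅ : Set E)) T)
  have heq0 : Algebra.trdeg K (adjoin (adjoin K (∅ : Set E)) T) = Algebra.trdeg K (adjoin K T) := by
    have h1 : Algebra.trdeg K ↥(adjoin K T) = Algebra.trdeg K ↥(adjoin K (∅ ∪ T)) := by
      rw [Set.empty_union]
    rw [h1, ← (equivOfEq (adjoin_adjoin_left K ∅ T)).trdeg_eq]
    rfl
  have hzero : Algebra.trdeg K ↥(adjoin K (∅ : Set E)) = 0 :=
    nonpos_iff_eq_zero.mp ((trdeg_adjoin_le_mk (F := K) (∅ : Set E)).trans (by simp))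
  rw [hzero, zero_add, heq0] at htower0
  rw [heq] at htower
  rw [← htower, ← htower0]
  gcongr


/-! ### Lemma A: a transcendental multiplier with a large overlap forces small transcendence degree -/

/-- **Lemma A.** Let `u₁, …, u_d ∈ ℂ`, `X = span_ℚ(u)`, `ρ ∈ ℂ` transcendental over `ℚ`, and
`W = {v ∈ X ; ρv ∈ X}`. Then `trdeg_ℚ ℚ(u) + dim_ℚ W ≤ d + 1`. (Write `X = W ⊕ C`; for `v ∈ W`,
`ρv = ψ(v) + c(v)` with `ψ : W → W` linear and `c(v) ∈ C`; by induction `ρᵏv ≡ ψᵏv` modulo the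
field `F = ℚ(ρ, C)`; with `p = charpoly ψ`, Cayley–Hamilton gives `p(ρ)v ∈ F`, and `p(ρ) ≠ 0`
because `ρ` is transcendental, so `v ∈ F`; hence `X ⊆ F` and `trdeg ℚ(u) ≤ 1 + dim C`.)
[folklore] -/
theorem trdeg_add_finrank_stab_le {d : ℕ} (u : Fin d → ℂ) {ρ : ℂ} (hρ : Transcendental ℚ ρ) :
    Algebra.trdeg ℚ ↥(adjoin ℚ (Set.range u)) +
        (Module.finrank ℚ ↥(Submodule.span ℚ (Set.range u) ⊓
            (Submodule.span ℚ (Set.range u)).comap (LinearMap.mulLeft ℚ ρ)) : Cardinal) ≤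
      (d : Cardinal) + 1 := by
  set X : Submodule ℚ ℂ := Submodule.span ℚ (Set.range u) with hX
  set W : Submodule ℚ ℂ := X ⊓ X.comap (LinearMap.mulLeft ℚ ρ) with hW
  have hWX : W ≤ X := inf_le_left
  haveI : FiniteDimensional ℚ X := FiniteDimensional.span_of_finite ℚ (Set.finite_range u)
  haveI : FiniteDimensional ℚ W := Submodule.finiteDimensional_of_le hWX
  -- a complement of `W` in `ℂ`, cut down to `X`
  obtain ⟨C, hC⟩ := Submodule.exists_isCompl W
  set CX : Submodule ℚ ℂ := X ⊓ C with hCX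
  haveI : FiniteDimensional ℚ CX := Submodule.finiteDimensional_of_le inf_le_left
  -- `X = W ⊕ CX`
  have hsup : W ⊔ CX = X := by
    refine le_antisymm (sup_le hWX inf_le_left) (fun v hv => ?_)
    rw [Submodule.mem_sup]
    refine ⟨W.projection C hC v, Submodule.projection_apply_mem hC v, v - W.projection C hC v,
      ⟨?_, Submodule.sub_projection_mem hC v⟩, by abel⟩
    exact X.sub_mem hv (hWX (Submodule.projection_apply_mem hC v))
  have hinf : W ⊓ CX = ⊥ :=
    le_bot_iff.mp ((inf_le_inf_left W inf_le_right).trans hC.inf_eq_bot.le)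
  have hdim : Module.finrank ℚ W + Module.finrank ℚ CX = Module.finrank ℚ X := by
    have h := Submodule.finrank_sup_add_finrank_inf_eq W CX
    rw [hsup, hinf, finrank_bot, add_zero] at h
    exact h.symm
  have hXd : Module.finrank ℚ X ≤ d := by
    have h := finrank_range_le_card (R := ℚ) u
    rw [Fintype.card_fin] at h
    exact h
  -- the field `F = ℚ(ρ, basis of CX)`
  set n := Module.finrank ℚ CX with hn
  let bC := Module.finBasis ℚ CX
  let c : Fin n → ℂ := fun k => (bC k : ℂ)
  set F : IntermediateField ℚ ℂ := adjoin ℚ (insert ρ (Set.range c)) with hF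
  have hρF : ρ ∈ F := subset_adjoin ℚ _ (Set.mem_insert _ _)
  have hCF : ∀ v ∈ CX, v ∈ F := by
    intro v hv
    have hrepr := bC.sum_repr ⟨v, hv⟩
    have hmem : ((∑ k, bC.repr ⟨v, hv⟩ k • bC k : CX) : ℂ) ∈ F := by
      rw [Submodule.coe_sum]
      refine sum_mem (fun k _ => ?_)
      rw [Submodule.coe_smul]
      have hck : c k ∈ F :=
        subset_adjoin ℚ (insert ρ (Set.range c)) (Set.mem_insert_of_mem ρ (Set.mem_range_self k))
      exact smul_mem _ hck
    rwa [hrepr] at hmem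
  -- `ψ : W → W`, `ψ v = W-component of ρv`
  let ψ : W →ₗ[ℚ] W := (W.projectionOnto C hC) ∘ₗ ((LinearMap.mulLeft ℚ ρ) ∘ₗ W.subtype)
  have hψ : ∀ w : W, ρ * (w : ℂ) - ((ψ w : W) : ℂ) ∈ F := by
    intro w
    have hψw : ((ψ w : W) : ℂ) = W.projection C hC (ρ * (w : ℂ)) := rfl
    have h1 : ρ * (w : ℂ) - ((ψ w : W) : ℂ) ∈ C := by
      rw [hψw]
      exact Submodule.sub_projection_mem hC (ρ * (w : ℂ))
    have h2 : ρ * (w : ℂ) - ((ψ w : W) : ℂ) ∈ X := by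
      refine X.sub_mem ?_ (hWX (ψ w).2)
      have hw : (w : ℂ) ∈ X ⊓ X.comap (LinearMap.mulLeft ℚ ρ) := w.2
      have hw2 := (Submodule.mem_inf.mp hw).2
      rw [Submodule.mem_comap, LinearMap.mulLeft_apply] at hw2
      exact hw2
    exact hCF _ ⟨h2, h1⟩
  -- `ρᵏ w ≡ ψᵏ w (mod F)`
  have hpow : ∀ (k : ℕ) (w : W), ρ ^ k * (w : ℂ) - (((ψ ^ k) w : W) : ℂ) ∈ F := by
    intro k
    induction k with
    | zero => intro w; simp
    | succ k ih =>
      intro w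
      have hsplit : ρ ^ (k + 1) * (w : ℂ) - (((ψ ^ (k + 1)) w : W) : ℂ) =
          ρ * (ρ ^ k * (w : ℂ) - (((ψ ^ k) w : W) : ℂ)) +
            (ρ * ((((ψ ^ k) w : W)) : ℂ) - ((ψ ((ψ ^ k) w) : W) : ℂ)) := by
        rw [pow_succ', pow_succ', Module.End.mul_apply]
        ring
      rw [hsplit]
      exact add_mem (mul_mem hρF (ih w)) (hψ _)
  -- Cayley–Hamilton: `p(ρ) w ∈ F` for `p = charpoly ψ`
  set p : Polynomial ℚ := ψ.charpoly with hp
  have hpρ_mem : Polynomial.aeval ρ p ∈ F := by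
    rw [Polynomial.aeval_eq_sum_range]
    exact sum_mem (fun i _ => smul_mem _ (pow_mem hρF i))
  have hpρ_ne : Polynomial.aeval ρ p ≠ 0 := by
    intro h0
    exact hρ ⟨p, (LinearMap.charpoly_monic ψ).ne_zero, h0⟩
  have hWF : ∀ w : W, (w : ℂ) ∈ F := by
    intro w
    have hsum : Polynomial.aeval ρ p * (w : ℂ) - ((Polynomial.aeval ψ p w : W) : ℂ) ∈ F := by
      have hrew : Polynomial.aeval ρ p * (w : ℂ) - ((Polynomial.aeval ψ p w : W) : ℂ) =
          ∑ i ∈ Finset.range (p.natDegree + 1),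
            (p.coeff i) • (ρ ^ i * (w : ℂ) - (((ψ ^ i) w : W) : ℂ)) := by
        rw [Polynomial.aeval_eq_sum_range, Polynomial.aeval_eq_sum_range]
        simp only [LinearMap.coe_sum, Finset.sum_apply, LinearMap.smul_apply,
          Submodule.coe_sum, Submodule.coe_smul, Finset.sum_mul, smul_sub,
          Finset.sum_sub_distrib, smul_mul_assoc]
      rw [hrew]
      exact sum_mem (fun i _ => smul_mem _ (hpow i w))
    have hCH : Polynomial.aeval ψ p = 0 := by
      rw [hp]; exact LinearMap.aeval_self_charpoly ψ
    rw [hCH] at hsum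
    simp only [LinearMap.zero_apply, Submodule.coe_zero, sub_zero] at hsum
    have : (w : ℂ) = (Polynomial.aeval ρ p)⁻¹ * (Polynomial.aeval ρ p * (w : ℂ)) := by
      rw [inv_mul_cancel_left₀ hpρ_ne]
    rw [this]
    exact mul_mem (inv_mem hpρ_mem) hsum
  -- hence `X ⊆ F` and `ℚ(u) ≤ F`
  have hXF : ∀ v ∈ X, v ∈ F := by
    intro v hv
    have : v ∈ W ⊔ CX := hsup.symm ▸ hv
    obtain ⟨w, hw, z, hz, rfl⟩ := Submodule.mem_sup.mp this
    exact add_mem (hWF ⟨w, hw⟩) (hCF z hz)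
  have hle : adjoin ℚ (Set.range u) ≤ F :=
    adjoin_le_iff.mpr fun v hv => hXF v (Submodule.subset_span hv)
  -- count
  have h1 : Algebra.trdeg ℚ ↥(adjoin ℚ (Set.range u)) ≤ (n : Cardinal) + 1 := by
    refine (trdeg_mono hle).trans ((trdeg_adjoin_le_mk _).trans ?_)
    refine (Cardinal.mk_insert_le).trans ?_
    gcongr
    simpa using Cardinal.mk_range_le (f := c)
  calc Algebra.trdeg ℚ ↥(adjoin ℚ (Set.range u)) + (Module.finrank ℚ W : Cardinal)
      ≤ ((n : Cardinal) + 1) + (Module.finrank ℚ W : Cardinal) := by gcongr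
    _ = ((n + Module.finrank ℚ W + 1 : ℕ) : Cardinal) := by push_cast; ring
    _ ≤ ((d + 1 : ℕ) : Cardinal) := by exact_mod_cast (by omega)
    _ = (d : Cardinal) + 1 := by push_cast; rfl

/-! ### Rank-one grids: columns, their spans and the fields they generate -/

section Grid

variable {d l : ℕ}

/-- Column `j` of the grid `(xᵢyⱼ)`: the tuple `(x₁yⱼ, …, x_dyⱼ)`. [folklore] -/
def gridCol (x : Fin d → ℂ) (y : Fin l → ℂ) (j : Fin l) : Fin d → ℂ := fun i => x i * y j

/-- The set of products `xᵢyⱼ` with `j` in a finite set `J` of columns. [folklore] -/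
def gridCols (x : Fin d → ℂ) (y : Fin l → ℂ) (J : Finset (Fin l)) : Set ℂ :=
  ⋃ j ∈ J, Set.range (gridCol x y j)

section
variable (x : Fin d → ℂ) (y : Fin l → ℂ)

/-- Unfolding lemma for `gridCol`. [folklore] -/
@[simp] theorem gridCol_apply (j : Fin l) (i : Fin d) : gridCol x y j i = x i * y j := rfl

/-- `gridCols` of `insert k J` is column `k` together with `gridCols J`. [folklore] -/
theorem gridCols_insert (k : Fin l) (J : Finset (Fin l)) :
    gridCols x y (insert k J) = Set.range (gridCol x y k) ∪ gridCols x y J := by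
  simp [gridCols]

/-- `gridCols` of a single column. [folklore] -/
theorem gridCols_singleton (j : Fin l) : gridCols x y {j} = Set.range (gridCol x y j) := by
  simp [gridCols]

/-- A column with index in `J` lies in `gridCols J`. [folklore] -/
theorem range_gridCol_subset_gridCols {J : Finset (Fin l)} {j : Fin l} (hj : j ∈ J) :
    Set.range (gridCol x y j) ⊆ gridCols x y J := by
  intro z hz
  simp only [gridCols, Set.mem_iUnion]
  exact ⟨j, hj, hz⟩

/-- All the columns together give the whole grid `{xᵢyⱼ}`. [folklore] -/
theorem gridCols_univ :
    gridCols x y Finset.univ = Set.range (fun p : Fin d × Fin l => x p.1 * y p.2) := by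
  ext z
  simp only [gridCols, Finset.mem_univ, Set.iUnion_true, Set.mem_iUnion, Set.mem_range,
    gridCol_apply, Prod.exists]
  constructor
  · rintro ⟨j, i, rfl⟩
    exact ⟨i, j, rfl⟩
  · rintro ⟨i, j, rfl⟩
    exact ⟨j, i, rfl⟩

/-- `gridCols J` is a finite set. [folklore] -/
theorem finite_gridCols (J : Finset (Fin l)) : (gridCols x y J).Finite :=
  J.finite_toSet.biUnion fun _ _ => Set.finite_range _

end

variable {x : Fin d → ℂ} {y : Fin l → ℂ}

/-- A column of the grid is `ℚ`-linearly independent when `x` is and `yⱼ ≠ 0`. [folklore] -/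
theorem linearIndependent_gridCol (hx : LinearIndependent ℚ x) {j : Fin l} (hj : y j ≠ 0) :
    LinearIndependent ℚ (gridCol x y j) := by
  rw [Fintype.linearIndependent_iff] at hx ⊢
  intro g hg i
  refine hx g ?_ i
  have hsum : (∑ k, g k • x k) * y j = 0 := by
    rw [Finset.sum_mul]
    simpa [smul_mul_assoc] using hg
  exact (mul_eq_zero.mp hsum).resolve_right hj

/-- The span of a column has dimension `d` (for `x` independent and `yⱼ ≠ 0`). [folklore] -/
theorem finrank_span_gridCol (hx : LinearIndependent ℚ x) {j : Fin l} (hj : y j ≠ 0) :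
    Module.finrank ℚ (Submodule.span ℚ (Set.range (gridCol x y j))) = d := by
  rw [finrank_span_eq_card (linearIndependent_gridCol hx hj), Fintype.card_fin]

/-- Adding a column adds one field generator: `ℚ(columns J ∪ {k}) = ℚ(columns J)(x_{i₀}y_k)` when
`j₀ ∈ J`, because `xᵢy_k = (x_{i₀}y_k)(xᵢy_{j₀})/(x_{i₀}y_{j₀})`. [folklore] -/
theorem adjoin_gridCols_insert {J : Finset (Fin l)} {i₀ : Fin d} {j₀ : Fin l} (hj₀ : j₀ ∈ J)
    (hx₀ : x i₀ ≠ 0) (hy₀ : y j₀ ≠ 0) (k : Fin l) :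
    adjoin ℚ (gridCols x y (insert k J)) = adjoin ℚ (insert (x i₀ * y k) (gridCols x y J)) := by
  refine le_antisymm ?_ ?_
  · rw [adjoin_le_iff, gridCols_insert]
    rintro z (⟨i, rfl⟩ | hz)
    · have hmem1 : x i₀ * y k ∈ adjoin ℚ (insert (x i₀ * y k) (gridCols x y J)) :=
        subset_adjoin ℚ _ (Set.mem_insert _ _)
      have hmem2 : x i * y j₀ ∈ adjoin ℚ (insert (x i₀ * y k) (gridCols x y J)) :=
        subset_adjoin ℚ _
          (Set.mem_insert_of_mem _ (range_gridCol_subset_gridCols x y hj₀ ⟨i, rfl⟩))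
      have hmem3 : x i₀ * y j₀ ∈ adjoin ℚ (insert (x i₀ * y k) (gridCols x y J)) :=
        subset_adjoin ℚ _
          (Set.mem_insert_of_mem _ (range_gridCol_subset_gridCols x y hj₀ ⟨i₀, rfl⟩))
      have hid : gridCol x y k i = x i₀ * y k * (x i * y j₀) / (x i₀ * y j₀) := by
        rw [gridCol_apply]
        field_simp
      rw [hid]
      exact div_mem (mul_mem hmem1 hmem2) hmem3
    · exact subset_adjoin ℚ _ (Set.mem_insert_of_mem _ hz)
  · rw [adjoin_le_iff]
    rintro z (rfl | hz)
    · refine subset_adjoin ℚ _ ?_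
      rw [gridCols_insert]
      exact Or.inl ⟨i₀, rfl⟩
    · refine subset_adjoin ℚ _ ?_
      rw [gridCols_insert]
      exact Or.inr hz

/-- Hence adding a column raises the transcendence degree by at most one. [folklore] -/
theorem trdeg_adjoin_gridCols_insert_le {J : Finset (Fin l)} {i₀ : Fin d} {j₀ : Fin l}
    (hj₀ : j₀ ∈ J) (hx₀ : x i₀ ≠ 0) (hy₀ : y j₀ ≠ 0) (k : Fin l) :
    Algebra.trdeg ℚ ↥(adjoin ℚ (gridCols x y (insert k J))) ≤
      Algebra.trdeg ℚ ↥(adjoin ℚ (gridCols x y J)) + 1 := by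
  rw [adjoin_gridCols_insert hj₀ hx₀ hy₀ k]
  exact trdeg_adjoin_insert_le _ _

/-- If the span of the new column `k` meets the span of the columns `J ∋ j₀` non-trivially, then
the new column generates nothing new: `ℚ(columns J ∪ {k}) = ℚ(columns J)` (a common non-zero
element `u·y_k = v ∈ span(columns J)` with `u ∈ span(x)` gives
`x_{i₀}y_k = v·(x_{i₀}y_{j₀})/(u·y_{j₀}) ∈ ℚ(columns J)`). [folklore] -/
theorem adjoin_gridCols_insert_eq_of_inf_ne_bot {J : Finset (Fin l)} {i₀ : Fin d} {j₀ : Fin l}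
    (hj₀ : j₀ ∈ J) (hx₀ : x i₀ ≠ 0) (hy₀ : y j₀ ≠ 0) {k : Fin l}
    (h : Submodule.span ℚ (Set.range (gridCol x y k)) ⊓ Submodule.span ℚ (gridCols x y J) ≠ ⊥) :
    adjoin ℚ (gridCols x y (insert k J)) = adjoin ℚ (gridCols x y J) := by
  rw [adjoin_gridCols_insert hj₀ hx₀ hy₀ k]
  suffices hmem : x i₀ * y k ∈ adjoin ℚ (gridCols x y J) by
    refine le_antisymm (adjoin_le_iff.mpr ?_) (adjoin.mono ℚ _ _ (Set.subset_insert _ _))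
    rintro z (rfl | hz)
    · exact hmem
    · exact subset_adjoin ℚ _ hz
  obtain ⟨v, hv, hv0⟩ := (Submodule.ne_bot_iff _).mp h
  obtain ⟨hv1, hv2⟩ := Submodule.mem_inf.mp hv
  obtain ⟨c, hc⟩ := (Submodule.mem_span_range_iff_exists_fun ℚ).mp hv1
  set uu : ℂ := ∑ i, c i • x i with huu
  have hv_eq : v = uu * y k := by
    rw [← hc, huu, Finset.sum_mul]
    simp
  have huu0 : uu ≠ 0 := by
    rintro h0
    apply hv0
    rw [hv_eq, h0, zero_mul]
  set E := adjoin ℚ (gridCols x y J) with hE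
  have hvE : v ∈ E := span_le_adjoin _ hv2
  have huyE : uu * y j₀ ∈ E := by
    rw [huu, Finset.sum_mul]
    refine sum_mem (fun i _ => ?_)
    rw [smul_mul_assoc]
    exact smul_mem _ (subset_adjoin ℚ _ (range_gridCol_subset_gridCols x y hj₀ ⟨i, rfl⟩))
  have hx0y0E : x i₀ * y j₀ ∈ E :=
    subset_adjoin ℚ _ (range_gridCol_subset_gridCols x y hj₀ ⟨i₀, rfl⟩)
  have hid : x i₀ * y k = v * (x i₀ * y j₀) / (uu * y j₀) := by
    rw [hv_eq]
    field_simp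
  rw [hid]
  exact div_mem (mul_mem hvE hx0y0E) huyE

end Grid

end Literature.NumberTheory.Transcendental

end
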